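import Mathlib.Data.Real.Basic
import Mathlib.Tactic.Linarith
import Mathlib.Tactic.Positivity
import Mathlib.Tactic.FieldSimp
import Mathlib.Tactic.Ring
import HarnessLib

/-!
# QUANT lane R8, T-DEC: LEMMA W's two-row regime — the CORE INEQUALITY of the DIAGONAL certificate ("each low copy of `l` into the matching copy
# of `h`, the rest into the giant"): a three-variable lemma `(y, ρ₀, s)` proved by one square identity, and its two-copy (Cauchy–Schwarz) form
# (arm-1 gen 62, architect)

builds on p205010 (kernel theorem, internal audit signed; external expert review pending)

Support file (`--supports stmt-CriticalPhenomena-4575`), QUANT lane seat prim-quant-arm-1 (gen 62, architect); memo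
`run/shared/lean/prim/quant/prim-quant-arm-1-g62/ARCH-G62.md` §1–§2.  Pure real algebra; standard axioms, no sorries, no definitions.

THE SETTING (memo §1).  A light window pair `(l, h)` of LEMMA W (`γ = y² + (1−y)ρ₀`, `0 < ρ₀ < y`, `ρ₀ = (T₀ − 2l)/(h − l)`) glued with the three-point shift
`t = {0 : t₀, r : t₁, r+k : t₂}`; at the glued target `T = T₀ + a·m` the low copies `l`, `l+r` of `l` (weights `(1−γ)t₀`, `(1−γ)t₁`) face the copies `h`, `h+r`
(capacities `γt₀`, `γt₁`) at deficit ratios `ρ_0 = ν = (T−2l)/(h−l) ≥ y`, `ρ_1 = ν − 2ε`, and the giant copy `h+r+k` (capacity `γt₂`, usage `y/(1−y)`).  The DIAGONAL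
certificate ships copy `i` into copy `i` of `h` at the exact power and the remainder into the giant; for two HEAVY copies its inequality is
`t₀(1 − γ/ρ_0) + t₁(1 − γ/ρ_1) ≤ t₂·γ(1−y)/y`, and the band frame supplies `t₀ρ_0 + t₁ρ_1 ≤ ρ₀` (top copy of `l` unreachable, `a ≤ 1`) and `t₂ ≥ y`.
* **`diag_lemmaD`** (the core, three variables): `0 < ρ₀ ≤ y < 1`, `0 ≤ s ≤ 1 − y`, `s·y ≤ ρ₀` ⟹ `s − γs²/ρ₀ ≤ (1−s)·γ(1−y)/y` (cleared form).  Proof: the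
  quadratic `Q(s) = γys² − ρ₀(γ(1−y)+y)s + γ(1−y)ρ₀` takes the values `ρ₀(1−y)(y−ρ₀)²` at `s = ρ₀/y` and `y(1−y)²(y−ρ₀)²` at `s = 1−y` (ONE square identity,
  the same as arm-1 g61's `farTop_core`), and is monotone on the admissible range unless its discriminant is negative (three two-line cases).
* **`diag_twoCopy`**: the two-copy form above, by Cauchy–Schwarz `(t₀/ρ_0 + t₁/ρ_1)(t₀ρ_0 + t₁ρ_1) ≥ (t₀+t₁)²` and `diag_lemmaD` with `s = t₀ + t₁`.
* **`diag_share`**: bookkeeping — two leftovers `L₀ ≥ 0`, `L₁` with `L₀ + max(L₁,0) ≤ C` are covered by complementary shares `σ`, `1−σ` of a column of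
  capacity-times-power `C`.
The tight corner of the cell (`t₁ = ε = 0`, `t₂ = y`, `ρ₀ → y`, `ν = y/(1−y)`) is exactly the double root of the square identity (memo §1: exact census of
the diagonal certificate, arm-1 g61 explore/noA2.py `V0` 100 %, least slack 7·10⁻⁵ — it is this corner).

HONEST STATUS.  `GluedLemmaW` (flow form), `GluedDominatedMass`, the band, `SiblingStep`, `FarTreeRow` OPEN; RATE class (log\*) / honest sentence of
`run/shared/lean/prim/quant/README.md` unchanged.  [this work].  Nothing here is cited as a published result.
-/

namespace Summit.CriticalPhenomena.PercolationContinuityZ3.Theorems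
namespace Quant
namespace LawDec

/-- **LEMMA D (core of the diagonal certificate).**  `0 < y < 1`, `0 < ρ₀`, `γ = y² + (1−y)ρ₀`, `s ≤ 1 − y`, `s·y ≤ ρ₀` ⟹
`y·(sρ₀ − γs²) ≤ (1−s)·γ·(1−y)·ρ₀`, i.e. `s − γs²/ρ₀ ≤ (1−s)γ(1−y)/y`.  Three cases on the quadratic `Q(s) = γys² − ρ₀(γ(1−y)+y)s + γ(1−y)ρ₀`:
`γ(1+y) ≤ y` (decreasing down to `Q(ρ₀/y) = ρ₀(1−y)(y−ρ₀)²`), `ρ₀(γ(1−y)+y) ≥ 2γy(1−y)` (decreasing down to `Q(1−y) = y(1−y)²(y−ρ₀)²`), else negative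
discriminant. [this work] -/
theorem diag_lemmaD (y ρ s : ℝ) (hy0 : 0 < y) (hy1 : y < 1) (hρ0 : 0 < ρ) (hs1 : s ≤ 1 - y) (hsy : s * y ≤ ρ) :
    y * (s * ρ - (y ^ 2 + (1 - y) * ρ) * s ^ 2) ≤ (1 - s) * (y ^ 2 + (1 - y) * ρ) * (1 - y) * ρ := by
  obtain ⟨g, hg⟩ : ∃ g : ℝ, g = y ^ 2 + (1 - y) * ρ := ⟨_, rfl⟩
  have h1y : 0 < 1 - y := by linarith
  have hg0 : 0 < g := by rw [hg]; positivity
  rw [← hg]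
  -- Q := RHS − LHS
  have eQ : (1 - s) * g * (1 - y) * ρ - y * (s * ρ - g * s ^ 2) = g * y * s ^ 2 - ρ * (g * (1 - y) + y) * s + g * (1 - y) * ρ := by ring
  suffices hQ : 0 ≤ g * y * s ^ 2 - ρ * (g * (1 - y) + y) * s + g * (1 - y) * ρ by linarith [eQ]
  by_cases h1 : g * (1 + y) ≤ y
  · -- y·Q = yρ(1−y)(y−ρ)² + (ρ − sy)·(ρ(y − g(1+y)) + g(ρ − sy))
    have e1 : y * (g * y * s ^ 2 - ρ * (g * (1 - y) + y) * s + g * (1 - y) * ρ)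
        = y * ρ * (1 - y) * (y - ρ) ^ 2 + (ρ - s * y) * (ρ * (y - g * (1 + y)) + g * (ρ - s * y)) := by
      rw [hg]; ring
    have hA : 0 ≤ ρ - s * y := by linarith
    have hB : 0 ≤ ρ * (y - g * (1 + y)) + g * (ρ - s * y) :=
      add_nonneg (mul_nonneg hρ0.le (by linarith)) (mul_nonneg hg0.le hA)
    have hC : 0 ≤ y * ρ * (1 - y) * (y - ρ) ^ 2 := by positivity
    have : 0 ≤ y * (g * y * s ^ 2 - ρ * (g * (1 - y) + y) * s + g * (1 - y) * ρ) := by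
      rw [e1]; exact add_nonneg hC (mul_nonneg hA hB)
    exact (mul_nonneg_iff_of_pos_left hy0).1 this
  · by_cases h2 : 2 * g * y * (1 - y) ≤ ρ * (g * (1 - y) + y)
    · -- Q = y(1−y)²(y−ρ)² + (1−y−s)·((ρ(g(1−y)+y) − 2gy(1−y)) + gy(1−y−s))
      have e2 : g * y * s ^ 2 - ρ * (g * (1 - y) + y) * s + g * (1 - y) * ρ
          = y * (1 - y) ^ 2 * (y - ρ) ^ 2 + (1 - y - s) * ((ρ * (g * (1 - y) + y) - 2 * g * y * (1 - y)) + g * y * (1 - y - s)) := by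
        rw [hg]; ring
      rw [e2]
      have hA : 0 ≤ 1 - y - s := by linarith
      have hB : 0 ≤ (ρ * (g * (1 - y) + y) - 2 * g * y * (1 - y)) + g * y * (1 - y - s) :=
        add_nonneg (by linarith) (mul_nonneg (mul_nonneg hg0.le hy0.le) hA)
      have hC : 0 ≤ y * (1 - y) ^ 2 * (y - ρ) ^ 2 := by positivity
      exact add_nonneg hC (mul_nonneg hA hB)
    · -- 4gy·Q = (2gys − ρ(g(1−y)+y))² + ρ·G,  G = 2gy(1−y)(g(1+y) − y) + (g(1−y)+y)(2gy(1−y) − ρ(g(1−y)+y)) > 0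
      have h1' : y < g * (1 + y) := lt_of_not_ge h1
      have h2' : ρ * (g * (1 - y) + y) < 2 * g * y * (1 - y) := lt_of_not_ge h2
      have e3 : 4 * g * y * (g * y * s ^ 2 - ρ * (g * (1 - y) + y) * s + g * (1 - y) * ρ)
          = (2 * g * y * s - ρ * (g * (1 - y) + y)) ^ 2
            + ρ * (2 * g * y * (1 - y) * (g * (1 + y) - y) + (g * (1 - y) + y) * (2 * g * y * (1 - y) - ρ * (g * (1 - y) + y))) := by
        ring
      have hG : 0 ≤ 2 * g * y * (1 - y) * (g * (1 + y) - y) + (g * (1 - y) + y) * (2 * g * y * (1 - y) - ρ * (g * (1 - y) + y)) := by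
        have a1 : 0 ≤ 2 * g * y * (1 - y) * (g * (1 + y) - y) := mul_nonneg (by positivity) (by linarith)
        have a2 : 0 ≤ (g * (1 - y) + y) * (2 * g * y * (1 - y) - ρ * (g * (1 - y) + y)) :=
          mul_nonneg (by positivity) (by linarith)
        linarith
      have h4 : 0 ≤ 4 * g * y * (g * y * s ^ 2 - ρ * (g * (1 - y) + y) * s + g * (1 - y) * ρ) := by
        rw [e3]; exact add_nonneg (sq_nonneg _) (mul_nonneg hρ0.le hG)
      have h4gy : 0 < 4 * g * y := by positivity
      exact (mul_nonneg_iff_of_pos_left h4gy).1 h4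

/-- **THE TWO-COPY FORM (heavy copies).**  `0 < y < 1`, `0 < ρ₀`, `γ = y² + (1−y)ρ₀`, `t₀, t₁ ≥ 0`, `t₀ + t₁ ≤ 1 − y`, ratios `ρ_0, ρ_1 ≥ y` with
`t₀ρ_0 + t₁ρ_1 ≤ ρ₀` ⟹ `t₀(1 − γ/ρ_0) + t₁(1 − γ/ρ_1) ≤ (1 − t₀ − t₁)·γ·(1−y)/y`.  (Cauchy–Schwarz `(t₀+t₁)² ≤ (t₀/ρ_0 + t₁/ρ_1)(t₀ρ_0 + t₁ρ_1)`, then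
`diag_lemmaD` with `s = t₀ + t₁`, `s·y ≤ t₀ρ_0 + t₁ρ_1 ≤ ρ₀`.) [this work] -/
theorem diag_twoCopy (y ρ t0 t1 ra rb : ℝ) (hy0 : 0 < y) (hy1 : y < 1) (hρ0 : 0 < ρ) (ht0 : 0 ≤ t0) (ht1 : 0 ≤ t1)
    (hs1 : t0 + t1 ≤ 1 - y) (hra : y ≤ ra) (hrb : y ≤ rb) (hsum : t0 * ra + t1 * rb ≤ ρ) :
    t0 * (1 - (y ^ 2 + (1 - y) * ρ) / ra) + t1 * (1 - (y ^ 2 + (1 - y) * ρ) / rb)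
      ≤ (1 - t0 - t1) * (y ^ 2 + (1 - y) * ρ) * ((1 - y) / y) := by
  obtain ⟨g, hg⟩ : ∃ g : ℝ, g = y ^ 2 + (1 - y) * ρ := ⟨_, rfl⟩
  have h1y : 0 < 1 - y := by linarith
  have hg0 : 0 < g := by rw [hg]; positivity
  have hra0 : 0 < ra := lt_of_lt_of_le hy0 hra
  have hrb0 : 0 < rb := lt_of_lt_of_le hy0 hrb
  rw [← hg]
  -- u = t0/ra, v = t1/rb
  obtain ⟨u, hu⟩ : ∃ u : ℝ, u = t0 / ra := ⟨_, rfl⟩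
  obtain ⟨v, hv⟩ : ∃ v : ℝ, v = t1 / rb := ⟨_, rfl⟩
  have hu0 : 0 ≤ u := by rw [hu]; positivity
  have hv0 : 0 ≤ v := by rw [hv]; positivity
  have et0 : t0 = u * ra := by rw [hu, div_mul_cancel₀ _ hra0.ne']
  have et1 : t1 = v * rb := by rw [hv, div_mul_cancel₀ _ hrb0.ne']
  have eL : t0 * (1 - g / ra) + t1 * (1 - g / rb) = (t0 + t1) - g * (u + v) := by
    rw [et0, et1]; field_simp; ring
  rw [eL]
  set s := t0 + t1 with hs
  have hs0 : 0 ≤ s := by rw [hs]; linarith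
  -- Cauchy–Schwarz: (u+v)(t0 ra + t1 rb) ≥ s², hence (u+v) ρ ≥ s²
  have hCS : s ^ 2 ≤ (u + v) * (t0 * ra + t1 * rb) := by
    have e : (u + v) * (t0 * ra + t1 * rb) - s ^ 2 = u * v * (ra - rb) ^ 2 := by rw [hs, et0, et1]; ring
    nlinarith [mul_nonneg (mul_nonneg hu0 hv0) (sq_nonneg (ra - rb))]
  have hCS' : s ^ 2 ≤ (u + v) * ρ := le_trans hCS (mul_le_mul_of_nonneg_left hsum (add_nonneg hu0 hv0))
  -- s y ≤ ρ
  have hsy : s * y ≤ ρ := by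
    have : s * y ≤ t0 * ra + t1 * rb := by
      rw [hs, add_mul]; exact add_le_add (mul_le_mul_of_nonneg_left hra ht0) (mul_le_mul_of_nonneg_left hrb ht1)
    linarith
  have hD := diag_lemmaD y ρ s hy0 hy1 hρ0 hs1 hsy
  rw [← hg] at hD
  -- s − g(u+v) ≤ s − g s²/ρ ≤ (1−s) g (1−y)/y
  have h1 : g * s ^ 2 ≤ g * ((u + v) * ρ) := mul_le_mul_of_nonneg_left hCS' hg0.le
  have h2 : y * (s * ρ - g * ((u + v) * ρ)) ≤ (1 - s) * g * (1 - y) * ρ := by nlinarith [mul_le_mul_of_nonneg_left h1 hy0.le]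
  -- divide by ρ y
  have h3 : (s - g * (u + v)) * (ρ * y) ≤ ((1 - s) * g * ((1 - y) / y)) * (ρ * y) := by
    have e1 : (s - g * (u + v)) * (ρ * y) = y * (s * ρ - g * ((u + v) * ρ)) := by ring
    have e2 : ((1 - s) * g * ((1 - y) / y)) * (ρ * y) = (1 - s) * g * (1 - y) * ρ := by field_simp
    rw [e1, e2]; exact h2
  have := le_of_mul_le_mul_right h3 (mul_pos hρ0 hy0)
  rw [hs] at this
  have e4 : 1 - (t0 + t1) = 1 - t0 - t1 := by ring
  rw [e4] at this
  exact this

/-- **complementary shares.**  Leftovers `L₀ ≥ 0` and `L₁` with `L₀ + L₁ ≤ C`, `L₀ ≤ C`, `0 < C`: there is `σ ∈ [0,1]` with `L₀ ≤ σC` and `L₁ ≤ (1−σ)C`.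
[folklore] -/
theorem diag_share (L0 L1 C : ℝ) (hC : 0 < C) (hL0 : 0 ≤ L0) (h0 : L0 ≤ C) (h01 : L0 + L1 ≤ C) :
    ∃ σ : ℝ, 0 ≤ σ ∧ σ ≤ 1 ∧ L0 ≤ σ * C ∧ L1 ≤ (1 - σ) * C := by
  refine ⟨L0 / C, div_nonneg hL0 hC.le, (div_le_one hC).2 h0, ?_, ?_⟩
  · rw [div_mul_cancel₀ _ hC.ne']
  · rw [sub_mul, div_mul_cancel₀ _ hC.ne', one_mul]; linarith

end LawDec
end Quant
end Summit.CriticalPhenomena.PercolationContinuityZ3.Theorems
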